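import Literature.Probability.Distributions.BrascampLiebDensity
import Literature.Analysis.Complex.FlatTubeFourier
import HarnessLib

/-!
# Differentiating fiber integrals: the marginal potential `g(y) = -log ∫ e^{-f(y,z)} dz`

`Literature/Probability/Distributions/`. The differentiation-under-the-integral-sign step of
Brascamp–Lieb 1976, Theorem 4.2 and p. 378 (eq. (4.8): `g_yy = ⟨f_yy⟩_z - var_z f_y`, and
`(d/dy)⟨h⟩_z = ⟨h_y⟩_z - cov_z(h, f_y)`), carried out for potentials `f ∈ C²(ℝⁿ⁺¹)` and
observables in the TAME class used by the induction:

* `f x ≥ c‖x‖ - C₀` (`c > 0`), and polynomial bounds `|Df(x)v| ≤ K(1+‖x‖)ᵏ‖v‖`,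
  `|D(x ↦ Df(x)v)(x)w| ≤ K(1+‖x‖)ᵏ‖v‖‖w‖`;
* observables `φ ∈ C¹` with `|φ|, |Dφ(x)v|/‖v‖ ≤ K'(1+‖x‖)^{k'}`.

Under these hypotheses every fiber integral `y ↦ ∫ e^{-f(y,z)} φ(y,z) dz` is differentiable with
the expected derivative (`hasDerivAt_fiberIntegral`) and continuous (`continuous_fiberIntegral`),
uniformly dominated by `(1+‖z‖)ᵐ e^{-c‖z‖}` (integrable on `ℝⁿ`,
`Literature.Analysis.Complex.integrable_one_add_norm_pow_mul_exp_neg`). Consequences: `g ∈ C²`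
with `g' = ⟨f_y⟩_z`, and `g` attains its minimum. The source performs these differentiations
under a uniform-convergence proviso (its (4.6)); the tame class is our way of meeting it.

Theorems only. References: H. J. Brascamp, E. H. Lieb, J. Funct. Anal. 22 (1976) 366–389,
Thm 4.2 and pp. 377–378. [BrascampLieb1976]
-/

noncomputable section

open MeasureTheory Filter Set Metric
open Literature.Analysis.Complex (integrable_one_add_norm_pow_mul_exp_neg)
open Literature.Analysis.OperatorTheory (norm_le_norm_cons)
open scoped ENNReal Topology

namespace Literature.Probability.Distributions

namespace BrascampLiebMarginal

open BrascampLiebCalculus BrascampLiebDensity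

variable {n : ℕ}

/-! ### Polynomial bounds: bookkeeping -/

section PolyBounds

variable {m : ℕ}

/-- Product of polynomially bounded functions. [folklore] -/
theorem polyBound_mul {φ ψ : (Fin m → ℝ) → ℝ} {K₁ K₂ : ℝ} {k₁ k₂ : ℕ} (hK₁ : 0 ≤ K₁)
    (h₁ : ∀ x, |φ x| ≤ K₁ * (1 + ‖x‖) ^ k₁) (h₂ : ∀ x, |ψ x| ≤ K₂ * (1 + ‖x‖) ^ k₂) (x : Fin m → ℝ) :
    |φ x * ψ x| ≤ K₁ * K₂ * (1 + ‖x‖) ^ (k₁ + k₂) := by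
  rw [abs_mul, pow_add]
  have := mul_le_mul (h₁ x) (h₂ x) (abs_nonneg _) (by positivity)
  linarith [this]

/-- Raising the exponent of a polynomial bound. [folklore] -/
theorem polyBound_mono {K : ℝ} {k k' : ℕ} (hK : 0 ≤ K) (hk : k ≤ k') (x : Fin m → ℝ) :
    K * (1 + ‖x‖) ^ k ≤ K * (1 + ‖x‖) ^ k' := by
  gcongr
  linarith [norm_nonneg x]

/-- Sum of polynomially bounded functions. [folklore] -/
theorem polyBound_add {φ ψ : (Fin m → ℝ) → ℝ} {K₁ K₂ : ℝ} {k₁ k₂ : ℕ} (hK₁ : 0 ≤ K₁) (hK₂ : 0 ≤ K₂)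
    (h₁ : ∀ x, |φ x| ≤ K₁ * (1 + ‖x‖) ^ k₁) (h₂ : ∀ x, |ψ x| ≤ K₂ * (1 + ‖x‖) ^ k₂) (x : Fin m → ℝ) :
    |φ x + ψ x| ≤ (K₁ + K₂) * (1 + ‖x‖) ^ (k₁ + k₂) := by
  have e1 := (h₁ x).trans (polyBound_mono hK₁ (Nat.le_add_right k₁ k₂) x)
  have e2 := (h₂ x).trans (polyBound_mono hK₂ (Nat.le_add_left k₂ k₁) x)
  calc |φ x + ψ x| ≤ |φ x| + |ψ x| := abs_add_le _ _
    _ ≤ _ := by linarith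

/-- The polynomial weight on a fiber: `(1 + ‖(y, z)‖)ᵏ ≤ (1 + |y|)ᵏ (1 + ‖z‖)ᵏ`. [folklore] -/
theorem one_add_norm_cons_pow_le (y : ℝ) (z : Fin n → ℝ) (k : ℕ) :
    (1 + ‖(Fin.cons y z : Fin (n + 1) → ℝ)‖) ^ k ≤ (1 + |y|) ^ k * (1 + ‖z‖) ^ k := by
  rw [← mul_pow]
  exact pow_le_pow_left₀ (by positivity) (one_add_norm_cons_le y z) k

end PolyBounds

/-! ### Domination of fiber integrands -/

/-- **Domination on fibers.** If `|φ| ≤ K'(1+‖x‖)^{k'}` and `f ≥ c‖x‖ - C₀`, then for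
`|y - y₀| ≤ 1` the fiber integrand is bounded by an integrable function of `z` alone:
`|e^{-f(y,z)} φ(y,z)| ≤ K' e^{C₀} (2+|y₀|)^{k'} · (1+‖z‖)^{k'} e^{-c‖z‖}`. [folklore] -/
theorem norm_fiberIntegrand_le {f φ : (Fin (n + 1) → ℝ) → ℝ} {K' : ℝ} {k' : ℕ} (hK' : 0 ≤ K')
    (hφb : ∀ x, |φ x| ≤ K' * (1 + ‖x‖) ^ k') {c C₀ : ℝ} (hc : 0 < c)
    (hcoer : ∀ x, c * ‖x‖ - C₀ ≤ f x) {y₀ y : ℝ} (hy : |y - y₀| ≤ 1) (z : Fin n → ℝ) :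
    ‖Real.exp (-f (Fin.cons y z)) * φ (Fin.cons y z)‖ ≤
      K' * Real.exp C₀ * (2 + |y₀|) ^ k' * ((1 + ‖z‖) ^ k' * Real.exp (-c * ‖z‖)) := by
  rw [Real.norm_eq_abs, abs_mul, abs_of_pos (Real.exp_pos _)]
  have hz : ‖z‖ ≤ ‖(Fin.cons y z : Fin (n + 1) → ℝ)‖ := norm_le_norm_cons y z
  have h1 : Real.exp (-f (Fin.cons y z)) ≤ Real.exp C₀ * Real.exp (-c * ‖z‖) := by
    rw [← Real.exp_add]
    refine Real.exp_le_exp.2 ?_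
    have := hcoer (Fin.cons y z)
    nlinarith
  have hyy : 1 + |y| ≤ 2 + |y₀| := by
    have : |y| ≤ |y - y₀| + |y₀| := by
      have := abs_add_le (y - y₀) y₀
      rwa [sub_add_cancel] at this
    linarith
  have h2 : |φ (Fin.cons y z)| ≤ K' * ((2 + |y₀|) ^ k' * (1 + ‖z‖) ^ k') := by
    refine (hφb _).trans ?_
    refine mul_le_mul_of_nonneg_left ?_ hK'
    refine (one_add_norm_cons_pow_le y z k').trans ?_
    gcongr
  calc Real.exp (-f (Fin.cons y z)) * |φ (Fin.cons y z)|
      ≤ (Real.exp C₀ * Real.exp (-c * ‖z‖)) * (K' * ((2 + |y₀|) ^ k' * (1 + ‖z‖) ^ k')) :=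
        mul_le_mul h1 h2 (abs_nonneg _) (by positivity)
    _ = K' * Real.exp C₀ * (2 + |y₀|) ^ k' * ((1 + ‖z‖) ^ k' * Real.exp (-c * ‖z‖)) := by ring

/-- The dominating function is integrable on `ℝⁿ`. [folklore] -/
theorem integrable_fiberBound {K' C₀ c : ℝ} (hc : 0 < c) (y₀ : ℝ) (k' : ℕ) :
    Integrable fun z : Fin n → ℝ =>
      K' * Real.exp C₀ * (2 + |y₀|) ^ k' * ((1 + ‖z‖) ^ k' * Real.exp (-c * ‖z‖)) :=
  (integrable_one_add_norm_pow_mul_exp_neg hc k').const_mul _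

/-- **Fiber integrability**: `z ↦ e^{-f(y,z)} φ(y,z)` is integrable for every `y`. [folklore] -/
theorem integrable_fiberIntegrand {f φ : (Fin (n + 1) → ℝ) → ℝ} (hf : Continuous f) (hφ : Continuous φ)
    {K' : ℝ} {k' : ℕ} (hK' : 0 ≤ K') (hφb : ∀ x, |φ x| ≤ K' * (1 + ‖x‖) ^ k') {c C₀ : ℝ} (hc : 0 < c)
    (hcoer : ∀ x, c * ‖x‖ - C₀ ≤ f x) (y : ℝ) :
    Integrable fun z : Fin n → ℝ => Real.exp (-f (Fin.cons y z)) * φ (Fin.cons y z) := by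
  refine (integrable_fiberBound (K' := K') (C₀ := C₀) hc y k').mono' ?_
    (ae_of_all _ fun z => norm_fiberIntegrand_le hK' hφb hc hcoer (by simp) z)
  have hc' : Continuous fun z : Fin n → ℝ => (Fin.cons y z : Fin (n + 1) → ℝ) := by fun_prop
  exact ((Real.continuous_exp.comp (hf.comp hc').neg).mul (hφ.comp hc')).aestronglyMeasurable

/-- Fiber integrability of `e^{-f(y,·)}` itself. [folklore] -/
theorem integrable_fiber_exp {f : (Fin (n + 1) → ℝ) → ℝ} (hf : Continuous f) {c C₀ : ℝ} (hc : 0 < c)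
    (hcoer : ∀ x, c * ‖x‖ - C₀ ≤ f x) (y : ℝ) :
    Integrable fun z : Fin n → ℝ => Real.exp (-f (Fin.cons y z)) := by
  have := integrable_fiberIntegrand (φ := fun _ => (1 : ℝ)) hf continuous_const (K' := 1) (k' := 0)
    zero_le_one (fun x => by simp) hc hcoer y
  simpa using this

/-- **Global integrability**: `e^{-f} φ ∈ L¹(ℝᵐ)` for `φ` polynomially bounded and `f ≥ c‖x‖ - C₀`.
[folklore] -/
theorem integrable_exp_neg_mul {m : ℕ} {f φ : (Fin m → ℝ) → ℝ} (hf : Continuous f) (hφ : Continuous φ)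
    {K' : ℝ} {k' : ℕ} (hφb : ∀ x, |φ x| ≤ K' * (1 + ‖x‖) ^ k') {c C₀ : ℝ} (hc : 0 < c)
    (hcoer : ∀ x, c * ‖x‖ - C₀ ≤ f x) :
    Integrable fun x : Fin m → ℝ => Real.exp (-f x) * φ x := by
  have hdom : Integrable fun x : Fin m → ℝ =>
      K' * Real.exp C₀ * ((1 + ‖x‖) ^ k' * Real.exp (-c * ‖x‖)) :=
    (integrable_one_add_norm_pow_mul_exp_neg hc k').const_mul _
  refine hdom.mono' (by fun_prop) (ae_of_all _ fun x => ?_)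
  rw [Real.norm_eq_abs, abs_mul, abs_of_pos (Real.exp_pos _)]
  have h1 : Real.exp (-f x) ≤ Real.exp C₀ * Real.exp (-c * ‖x‖) := by
    rw [← Real.exp_add]
    exact Real.exp_le_exp.2 (by linarith [hcoer x])
  calc Real.exp (-f x) * |φ x| ≤ (Real.exp C₀ * Real.exp (-c * ‖x‖)) * (K' * (1 + ‖x‖) ^ k') :=
        mul_le_mul h1 (hφb x) (abs_nonneg _) (by positivity)
    _ = K' * Real.exp C₀ * ((1 + ‖x‖) ^ k' * Real.exp (-c * ‖x‖)) := by ring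

/-- Global integrability of `e^{-f}`. [folklore] -/
theorem integrable_exp_neg {m : ℕ} {f : (Fin m → ℝ) → ℝ} (hf : Continuous f) {c C₀ : ℝ} (hc : 0 < c)
    (hcoer : ∀ x, c * ‖x‖ - C₀ ≤ f x) :
    Integrable fun x : Fin m → ℝ => Real.exp (-f x) := by
  have := integrable_exp_neg_mul (φ := fun _ => (1 : ℝ)) hf continuous_const (K' := 1) (k' := 0)
    (fun x => by simp) hc hcoer
  simpa using this

/-! ### Continuity and differentiability of fiber integrals -/

/-- **Continuity of fiber integrals** `y ↦ ∫ e^{-f(y,z)} ψ(y,z) dz` for continuous, polynomially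
bounded `ψ` (dominated convergence). [cite: BrascampLieb1976, Thm 4.2 (proof)] -/
theorem continuous_fiberIntegral {f ψ : (Fin (n + 1) → ℝ) → ℝ} (hf : Continuous f) (hψ : Continuous ψ)
    {K' : ℝ} {k' : ℕ} (hK' : 0 ≤ K') (hψb : ∀ x, |ψ x| ≤ K' * (1 + ‖x‖) ^ k') {c C₀ : ℝ} (hc : 0 < c)
    (hcoer : ∀ x, c * ‖x‖ - C₀ ≤ f x) :
    Continuous fun y : ℝ => ∫ z : Fin n → ℝ, Real.exp (-f (Fin.cons y z)) * ψ (Fin.cons y z) := by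
  have hcp : Continuous fun p : ℝ × (Fin n → ℝ) => (Fin.cons p.1 p.2 : Fin (n + 1) → ℝ) := by
    fun_prop
  refine continuous_iff_continuousAt.2 fun y₀ => ?_
  refine continuousAt_of_dominated (bound := fun z : Fin n → ℝ =>
    K' * Real.exp C₀ * (2 + |y₀|) ^ k' * ((1 + ‖z‖) ^ k' * Real.exp (-c * ‖z‖))) ?_ ?_
    (integrable_fiberBound hc y₀ k') ?_
  · refine Eventually.of_forall fun y => ?_
    have hc' : Continuous fun z : Fin n → ℝ => (Fin.cons y z : Fin (n + 1) → ℝ) := by fun_prop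
    exact ((Real.continuous_exp.comp (hf.comp hc').neg).mul (hψ.comp hc')).aestronglyMeasurable
  · have : ∀ᶠ y in 𝓝 y₀, |y - y₀| ≤ 1 := by
      have h := Metric.closedBall_mem_nhds y₀ (zero_lt_one)
      filter_upwards [h] with y hy
      simpa [Real.dist_eq] using hy
    filter_upwards [this] with y hy
    exact ae_of_all _ fun z => norm_fiberIntegrand_le hK' hψb hc hcoer hy z
  · refine ae_of_all _ fun z => ?_
    have : Continuous fun y : ℝ => (Fin.cons y z : Fin (n + 1) → ℝ) := by fun_prop
    exact ((Real.continuous_exp.comp (hf.comp this).neg).mul (hψ.comp this)).continuousAt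

/-- The `y`-derivative integrand `ψ = ∂_y φ - φ ∂_y f` is continuous and polynomially bounded.
[folklore] -/
theorem derivIntegrand_bound {f φ : (Fin (n + 1) → ℝ) → ℝ} (hf : ContDiff ℝ 1 f) (hφ : ContDiff ℝ 1 φ)
    {K : ℝ} {k : ℕ} (hK : 0 ≤ K) (hbd1 : ∀ x v, |fderiv ℝ f x v| ≤ K * (1 + ‖x‖) ^ k * ‖v‖)
    {K' : ℝ} {k' : ℕ} (hK' : 0 ≤ K') (hφb : ∀ x, |φ x| ≤ K' * (1 + ‖x‖) ^ k')
    (hφb1 : ∀ x v, |fderiv ℝ φ x v| ≤ K' * (1 + ‖x‖) ^ k' * ‖v‖) :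
    Continuous (fun x : Fin (n + 1) → ℝ =>
      fderiv ℝ φ x (Pi.single 0 1) - φ x * fderiv ℝ f x (Pi.single 0 1)) ∧
    ∀ x, |fderiv ℝ φ x (Pi.single 0 1) - φ x * fderiv ℝ f x (Pi.single 0 1)| ≤
      (K' + K' * K) * (1 + ‖x‖) ^ (k' + (k' + k)) := by
  have he₀ : ‖(Pi.single 0 1 : Fin (n + 1) → ℝ)‖ = 1 := by simp [Pi.norm_single]
  refine ⟨?_, fun x => ?_⟩
  · have h1 : Continuous fun x => fderiv ℝ φ x (Pi.single 0 1) :=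
      (hφ.continuous_fderiv one_ne_zero).clm_apply continuous_const
    have h2 : Continuous fun x => fderiv ℝ f x (Pi.single 0 1) :=
      (hf.continuous_fderiv one_ne_zero).clm_apply continuous_const
    exact h1.sub (hφ.continuous.mul h2)
  · have b1 : ∀ x, |fderiv ℝ φ x (Pi.single 0 1)| ≤ K' * (1 + ‖x‖) ^ k' := fun x => by
      simpa [he₀] using hφb1 x (Pi.single 0 1)
    have b1' : ∀ x, |fderiv ℝ f x (Pi.single 0 1)| ≤ K * (1 + ‖x‖) ^ k := fun x => by
      simpa [he₀] using hbd1 x (Pi.single 0 1)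
    have b2 : ∀ x, |-(φ x * fderiv ℝ f x (Pi.single 0 1))| ≤ K' * K * (1 + ‖x‖) ^ (k' + k) := fun x => by
      rw [abs_neg]
      exact polyBound_mul (ψ := fun x => fderiv ℝ f x (Pi.single 0 1)) hK' hφb b1' x
    have := polyBound_add (φ := fun x => fderiv ℝ φ x (Pi.single 0 1))
      (ψ := fun x => -(φ x * fderiv ℝ f x (Pi.single 0 1))) hK' (mul_nonneg hK' hK) b1 b2 x
    simpa only [sub_eq_add_neg] using this

/-- The derivative of a fiber integral is continuous: `y ↦ ∫ e^{-f(y,z)} (∂_y φ - φ ∂_y f)(y,z) dz`.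
[folklore] -/
theorem continuous_fiberIntegral_deriv {f φ : (Fin (n + 1) → ℝ) → ℝ} (hf : ContDiff ℝ 1 f)
    (hφ : ContDiff ℝ 1 φ) {K : ℝ} {k : ℕ} (hK : 0 ≤ K)
    (hbd1 : ∀ x v, |fderiv ℝ f x v| ≤ K * (1 + ‖x‖) ^ k * ‖v‖)
    {K' : ℝ} {k' : ℕ} (hK' : 0 ≤ K') (hφb : ∀ x, |φ x| ≤ K' * (1 + ‖x‖) ^ k')
    (hφb1 : ∀ x v, |fderiv ℝ φ x v| ≤ K' * (1 + ‖x‖) ^ k' * ‖v‖)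
    {c C₀ : ℝ} (hc : 0 < c) (hcoer : ∀ x, c * ‖x‖ - C₀ ≤ f x) :
    Continuous fun y : ℝ => ∫ z : Fin n → ℝ, Real.exp (-f (Fin.cons y z)) *
      (fderiv ℝ φ (Fin.cons y z) (Pi.single 0 1) -
        φ (Fin.cons y z) * fderiv ℝ f (Fin.cons y z) (Pi.single 0 1)) := by
  obtain ⟨hψc, hψb⟩ := derivIntegrand_bound hf hφ hK hbd1 hK' hφb hφb1
  exact continuous_fiberIntegral hf.continuous hψc (by positivity) hψb hc hcoer

/-- **Differentiation of fiber integrals under the integral sign.** For `f ∈ C¹` with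
`f ≥ c‖x‖ - C₀` and `|Df(x)v| ≤ K(1+‖x‖)ᵏ‖v‖`, and `φ ∈ C¹` with `|φ|`, `|Dφ(x)v|/‖v‖` bounded by
`K'(1+‖x‖)^{k'}`:
`(d/dy) ∫ e^{-f(y,z)} φ(y,z) dz = ∫ e^{-f(y,z)} (∂_y φ - φ ∂_y f)(y,z) dz`.
[cite: BrascampLieb1976, Thm 4.2 (proof) and p. 378] -/
theorem hasDerivAt_fiberIntegral {f φ : (Fin (n + 1) → ℝ) → ℝ} (hf : ContDiff ℝ 1 f) (hφ : ContDiff ℝ 1 φ)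
    {K : ℝ} {k : ℕ} (hK : 0 ≤ K) (hbd1 : ∀ x v, |fderiv ℝ f x v| ≤ K * (1 + ‖x‖) ^ k * ‖v‖)
    {K' : ℝ} {k' : ℕ} (hK' : 0 ≤ K') (hφb : ∀ x, |φ x| ≤ K' * (1 + ‖x‖) ^ k')
    (hφb1 : ∀ x v, |fderiv ℝ φ x v| ≤ K' * (1 + ‖x‖) ^ k' * ‖v‖)
    {c C₀ : ℝ} (hc : 0 < c) (hcoer : ∀ x, c * ‖x‖ - C₀ ≤ f x) (y₀ : ℝ) :
    HasDerivAt (fun y : ℝ => ∫ z : Fin n → ℝ, Real.exp (-f (Fin.cons y z)) * φ (Fin.cons y z))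
      (∫ z : Fin n → ℝ, Real.exp (-f (Fin.cons y₀ z)) *
        (fderiv ℝ φ (Fin.cons y₀ z) (Pi.single 0 1) -
          φ (Fin.cons y₀ z) * fderiv ℝ f (Fin.cons y₀ z) (Pi.single 0 1))) y₀ := by
  have hfc : Continuous f := hf.continuous
  have hφc : Continuous φ := hφ.continuous
  have hfd : Differentiable ℝ f := hf.differentiable one_ne_zero
  have hφd : Differentiable ℝ φ := hφ.differentiable one_ne_zero
  obtain ⟨hψc, hψb⟩ := derivIntegrand_bound hf hφ hK hbd1 hK' hφb hφb1
  have key := hasDerivAt_integral_of_dominated_loc_of_deriv_le (μ := (volume : Measure (Fin n → ℝ)))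
    (F := fun (y : ℝ) (z : Fin n → ℝ) => Real.exp (-f (Fin.cons y z)) * φ (Fin.cons y z))
    (F' := fun (y : ℝ) (z : Fin n → ℝ) => Real.exp (-f (Fin.cons y z)) *
      (fderiv ℝ φ (Fin.cons y z) (Pi.single 0 1) -
        φ (Fin.cons y z) * fderiv ℝ f (Fin.cons y z) (Pi.single 0 1)))
    (x₀ := y₀) (s := closedBall y₀ 1)
    (bound := fun z : Fin n → ℝ => (K' + K' * K) * Real.exp C₀ * (2 + |y₀|) ^ (k' + (k' + k)) *
      ((1 + ‖z‖) ^ (k' + (k' + k)) * Real.exp (-c * ‖z‖)))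
    (closedBall_mem_nhds y₀ zero_lt_one) ?_ ?_ ?_ ?_ ?_ ?_
  · exact key.2
  · refine Eventually.of_forall fun y => ?_
    have hc' : Continuous fun z : Fin n → ℝ => (Fin.cons y z : Fin (n + 1) → ℝ) := by fun_prop
    exact ((Real.continuous_exp.comp (hfc.comp hc').neg).mul (hφc.comp hc')).aestronglyMeasurable
  · exact integrable_fiberIntegrand hfc hφc hK' hφb hc hcoer y₀
  · have hc' : Continuous fun z : Fin n → ℝ => (Fin.cons y₀ z : Fin (n + 1) → ℝ) := by fun_prop
    exact ((Real.continuous_exp.comp (hfc.comp hc').neg).mul (hψc.comp hc')).aestronglyMeasurable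
  · refine ae_of_all _ fun z y hy => ?_
    have hy' : |y - y₀| ≤ 1 := by simpa [Real.dist_eq] using hy
    exact norm_fiberIntegrand_le (φ := fun x => fderiv ℝ φ x (Pi.single 0 1) -
      φ x * fderiv ℝ f x (Pi.single 0 1)) (by positivity) hψb hc hcoer hy' z
  · exact integrable_fiberBound hc y₀ _
  · refine ae_of_all _ fun z y _ => ?_
    -- derivative in `y` of `e^{-f(y,z)} φ(y,z)`
    have d1 : HasDerivAt (fun s : ℝ => f (Fin.cons s z)) (fderiv ℝ f (Fin.cons y z) (Pi.single 0 1)) y :=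
      hasDerivAt_fiber_left hfd z y
    have d2 : HasDerivAt (fun s : ℝ => φ (Fin.cons s z)) (fderiv ℝ φ (Fin.cons y z) (Pi.single 0 1)) y :=
      hasDerivAt_fiber_left hφd z y
    have d3 : HasDerivAt (fun s : ℝ => Real.exp (-f (Fin.cons s z)) * φ (Fin.cons s z))
        (Real.exp (-f (Fin.cons y z)) * -fderiv ℝ f (Fin.cons y z) (Pi.single 0 1) * φ (Fin.cons y z)
          + Real.exp (-f (Fin.cons y z)) * fderiv ℝ φ (Fin.cons y z) (Pi.single 0 1)) y :=
      (d1.neg.exp).mul d2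
    refine d3.congr_deriv ?_
    ring

/-! ### The marginal potential `g = -log Z` -/

section Potential

variable {f : (Fin (n + 1) → ℝ) → ℝ} {K c C₀ : ℝ} {k : ℕ}

/-- `Z'(y) = -∫ e^{-f(y,z)} ∂_y f(y,z) dz`. [cite: BrascampLieb1976, Thm 4.2 (proof)] -/
theorem hasDerivAt_fiberZ (hf : ContDiff ℝ 1 f) (hK : 0 ≤ K)
    (hbd1 : ∀ x v, |fderiv ℝ f x v| ≤ K * (1 + ‖x‖) ^ k * ‖v‖) (hc : 0 < c)
    (hcoer : ∀ x, c * ‖x‖ - C₀ ≤ f x) (y₀ : ℝ) :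
    HasDerivAt (fun y : ℝ => ∫ z : Fin n → ℝ, Real.exp (-f (Fin.cons y z)))
      (-∫ z : Fin n → ℝ, Real.exp (-f (Fin.cons y₀ z)) * fderiv ℝ f (Fin.cons y₀ z) (Pi.single 0 1))
      y₀ := by
  have h := hasDerivAt_fiberIntegral (φ := fun _ => (1 : ℝ)) hf contDiff_const hK hbd1 (K' := 1)
    (k' := 0) zero_le_one (fun x => by simp) (fun x v => by simp) hc hcoer y₀
  simp only [mul_one, fderiv_fun_const, Pi.zero_apply, _root_.zero_apply, zero_sub, one_mul,
    mul_neg, integral_neg] at h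
  exact h

/-- `Z` is continuous. [folklore] -/
theorem continuous_fiberZ (hf : Continuous f) (hc : 0 < c) (hcoer : ∀ x, c * ‖x‖ - C₀ ≤ f x) :
    Continuous fun y : ℝ => ∫ z : Fin n → ℝ, Real.exp (-f (Fin.cons y z)) := by
  have h := continuous_fiberIntegral (ψ := fun _ => (1 : ℝ)) hf continuous_const (K' := 1) (k' := 0)
    zero_le_one (fun x => by simp) hc hcoer (n := n)
  simpa using h

/-- `∂_y f` is `C¹`, polynomially bounded with polynomially bounded derivative (from the tame
bounds on `f`). [folklore] -/
theorem fy_bounds (hf : ContDiff ℝ 2 f)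
    (hbd1 : ∀ x v, |fderiv ℝ f x v| ≤ K * (1 + ‖x‖) ^ k * ‖v‖)
    (hbd2 : ∀ x v w, |fderiv ℝ (fun x' => fderiv ℝ f x' v) x w| ≤ K * (1 + ‖x‖) ^ k * ‖v‖ * ‖w‖) :
    ContDiff ℝ 1 (fun x => fderiv ℝ f x (Pi.single 0 1)) ∧
    (∀ x, |fderiv ℝ f x (Pi.single 0 1)| ≤ K * (1 + ‖x‖) ^ k) ∧
    (∀ x v, |fderiv ℝ (fun x' => fderiv ℝ f x' (Pi.single 0 1)) x v| ≤ K * (1 + ‖x‖) ^ k * ‖v‖) := by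
  have he₀ : ‖(Pi.single 0 1 : Fin (n + 1) → ℝ)‖ = 1 := by simp [Pi.norm_single]
  refine ⟨(hf.fderiv_right (m := 1) le_rfl).clm_apply contDiff_const, fun x => ?_, fun x v => ?_⟩
  · simpa [he₀] using hbd1 x (Pi.single 0 1)
  · simpa [he₀] using hbd2 x (Pi.single 0 1) v

/-- `A(y) := ∫ e^{-f} ∂_y f dz` has derivative `∫ e^{-f} (∂²_y f - (∂_y f)²) dz`.
[cite: BrascampLieb1976, Thm 4.2 (proof), eq. (4.8)] -/
theorem hasDerivAt_fiberA (hf : ContDiff ℝ 2 f) (hK : 0 ≤ K)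
    (hbd1 : ∀ x v, |fderiv ℝ f x v| ≤ K * (1 + ‖x‖) ^ k * ‖v‖)
    (hbd2 : ∀ x v w, |fderiv ℝ (fun x' => fderiv ℝ f x' v) x w| ≤ K * (1 + ‖x‖) ^ k * ‖v‖ * ‖w‖)
    (hc : 0 < c) (hcoer : ∀ x, c * ‖x‖ - C₀ ≤ f x) (y₀ : ℝ) :
    HasDerivAt (fun y : ℝ => ∫ z : Fin n → ℝ,
        Real.exp (-f (Fin.cons y z)) * fderiv ℝ f (Fin.cons y z) (Pi.single 0 1))
      (∫ z : Fin n → ℝ, Real.exp (-f (Fin.cons y₀ z)) *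
        (fderiv ℝ (fun x' => fderiv ℝ f x' (Pi.single 0 1)) (Fin.cons y₀ z) (Pi.single 0 1) -
          fderiv ℝ f (Fin.cons y₀ z) (Pi.single 0 1) * fderiv ℝ f (Fin.cons y₀ z) (Pi.single 0 1)))
      y₀ := by
  obtain ⟨h1, h2, h3⟩ := fy_bounds hf hbd1 hbd2
  exact hasDerivAt_fiberIntegral (φ := fun x => fderiv ℝ f x (Pi.single 0 1)) (hf.of_le one_le_two)
    h1 hK hbd1 hK h2 h3 hc hcoer y₀

/-- `A` is continuous. [folklore] -/
theorem continuous_fiberA (hf : ContDiff ℝ 2 f) (hK : 0 ≤ K)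
    (hbd1 : ∀ x v, |fderiv ℝ f x v| ≤ K * (1 + ‖x‖) ^ k * ‖v‖)
    (hbd2 : ∀ x v w, |fderiv ℝ (fun x' => fderiv ℝ f x' v) x w| ≤ K * (1 + ‖x‖) ^ k * ‖v‖ * ‖w‖)
    (hc : 0 < c) (hcoer : ∀ x, c * ‖x‖ - C₀ ≤ f x) :
    Continuous fun y : ℝ => ∫ z : Fin n → ℝ,
      Real.exp (-f (Fin.cons y z)) * fderiv ℝ f (Fin.cons y z) (Pi.single 0 1) := by
  obtain ⟨h1, h2, -⟩ := fy_bounds hf hbd1 hbd2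
  exact continuous_fiberIntegral hf.continuous h1.continuous hK h2 hc hcoer

/-- `B(y) := ∫ e^{-f} (∂²_y f - (∂_y f)²) dz` is continuous. [folklore] -/
theorem continuous_fiberB (hf : ContDiff ℝ 2 f) (hK : 0 ≤ K)
    (hbd1 : ∀ x v, |fderiv ℝ f x v| ≤ K * (1 + ‖x‖) ^ k * ‖v‖)
    (hbd2 : ∀ x v w, |fderiv ℝ (fun x' => fderiv ℝ f x' v) x w| ≤ K * (1 + ‖x‖) ^ k * ‖v‖ * ‖w‖)
    (hc : 0 < c) (hcoer : ∀ x, c * ‖x‖ - C₀ ≤ f x) :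
    Continuous fun y : ℝ => ∫ z : Fin n → ℝ, Real.exp (-f (Fin.cons y z)) *
      (fderiv ℝ (fun x' => fderiv ℝ f x' (Pi.single 0 1)) (Fin.cons y z) (Pi.single 0 1) -
        fderiv ℝ f (Fin.cons y z) (Pi.single 0 1) * fderiv ℝ f (Fin.cons y z) (Pi.single 0 1)) := by
  obtain ⟨h1, h2, h3⟩ := fy_bounds hf hbd1 hbd2
  have he₀ : ‖(Pi.single 0 1 : Fin (n + 1) → ℝ)‖ = 1 := by simp [Pi.norm_single]
  have b1 : ∀ x, |fderiv ℝ (fun x' => fderiv ℝ f x' (Pi.single 0 1)) x (Pi.single 0 1)| ≤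
      K * (1 + ‖x‖) ^ k := fun x => by simpa [he₀] using h3 x (Pi.single 0 1)
  have b2 : ∀ x, |-(fderiv ℝ f x (Pi.single 0 1) * fderiv ℝ f x (Pi.single 0 1))| ≤
      K * K * (1 + ‖x‖) ^ (k + k) := fun x => by
    rw [abs_neg]
    exact polyBound_mul hK h2 h2 x
  have hb : ∀ x, |fderiv ℝ (fun x' => fderiv ℝ f x' (Pi.single 0 1)) x (Pi.single 0 1) -
      fderiv ℝ f x (Pi.single 0 1) * fderiv ℝ f x (Pi.single 0 1)| ≤
      (K + K * K) * (1 + ‖x‖) ^ (k + (k + k)) := fun x => by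
    have := polyBound_add (φ := fun x => fderiv ℝ (fun x' => fderiv ℝ f x' (Pi.single 0 1)) x
      (Pi.single 0 1)) (ψ := fun x => -(fderiv ℝ f x (Pi.single 0 1) * fderiv ℝ f x (Pi.single 0 1)))
      hK (mul_nonneg hK hK) b1 b2 x
    simpa only [sub_eq_add_neg] using this
  have hcont : Continuous fun x => fderiv ℝ (fun x' => fderiv ℝ f x' (Pi.single 0 1)) x (Pi.single 0 1) -
      fderiv ℝ f x (Pi.single 0 1) * fderiv ℝ f x (Pi.single 0 1) :=
    ((h1.continuous_fderiv one_ne_zero).clm_apply continuous_const).sub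
      (h1.continuous.mul h1.continuous)
  exact continuous_fiberIntegral hf.continuous hcont (by positivity) hb hc hcoer

/-- **The marginal potential is `C²`** (the part of Theorem 4.2 we need): with
`Z(y) = ∫ e^{-f(y,z)} dz`, `A = ∫ e^{-f} ∂_y f`, `B = ∫ e^{-f}(∂²_y f - (∂_y f)²)`, the function
`g = -log Z` satisfies `g' = A/Z` and `(A/Z)' = (B Z + A²)/Z²` (that is, `g'' = ⟨f_yy⟩_z - var_z f_y`,
eq. (4.8)), the latter continuous. [cite: BrascampLieb1976, Thm 4.2, eq. (4.8)] -/
theorem hasDerivAt_potential (hf : ContDiff ℝ 2 f) (hK : 0 ≤ K)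
    (hbd1 : ∀ x v, |fderiv ℝ f x v| ≤ K * (1 + ‖x‖) ^ k * ‖v‖)
    (hbd2 : ∀ x v w, |fderiv ℝ (fun x' => fderiv ℝ f x' v) x w| ≤ K * (1 + ‖x‖) ^ k * ‖v‖ * ‖w‖)
    (hc : 0 < c) (hcoer : ∀ x, c * ‖x‖ - C₀ ≤ f x)
    {Z A B : ℝ → ℝ} (hZ : Z = fun y => ∫ z : Fin n → ℝ, Real.exp (-f (Fin.cons y z)))
    (hA : A = fun y => ∫ z : Fin n → ℝ, Real.exp (-f (Fin.cons y z)) * fderiv ℝ f (Fin.cons y z) (Pi.single 0 1))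
    (hB : B = fun y => ∫ z : Fin n → ℝ, Real.exp (-f (Fin.cons y z)) *
      (fderiv ℝ (fun x' => fderiv ℝ f x' (Pi.single 0 1)) (Fin.cons y z) (Pi.single 0 1) -
        fderiv ℝ f (Fin.cons y z) (Pi.single 0 1) * fderiv ℝ f (Fin.cons y z) (Pi.single 0 1)))
    (y : ℝ) :
    HasDerivAt (fun y => -Real.log (Z y)) (A y / Z y) y ∧
    HasDerivAt (fun y => A y / Z y) ((B y * Z y - A y * -A y) / Z y ^ 2) y ∧
    Continuous (fun y => (B y * Z y - A y * -A y) / Z y ^ 2) := by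
  have hZpos : ∀ y, 0 < Z y := fun y => by
    rw [hZ]; exact fiberZ_pos (integrable_fiber_exp hf.continuous hc hcoer) y
  have dZ : ∀ y, HasDerivAt Z (-A y) y := fun y => by
    rw [hZ, hA]; exact hasDerivAt_fiberZ (hf.of_le one_le_two) hK hbd1 hc hcoer y
  have dA : ∀ y, HasDerivAt A (B y) y := fun y => by
    rw [hA, hB]; exact hasDerivAt_fiberA hf hK hbd1 hbd2 hc hcoer y
  refine ⟨?_, (dA y).div (dZ y) (hZpos y).ne', ?_⟩
  · refine (((dZ y).log (hZpos y).ne').neg).congr_deriv ?_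
    field_simp
  · have cZ : Continuous Z := by rw [hZ]; exact continuous_fiberZ hf.continuous hc hcoer
    have cA : Continuous A := by rw [hA]; exact continuous_fiberA hf hK hbd1 hbd2 hc hcoer
    have cB : Continuous B := by rw [hB]; exact continuous_fiberB hf hK hbd1 hbd2 hc hcoer
    exact ((cB.mul cZ).sub (cA.mul cA.neg)).div (cZ.pow 2) fun y => (pow_pos (hZpos y) 2).ne'

/-- A decay bound for the fiber partition function: `Z(y) ≤ e^{C₀} I e^{-c|y|/2}` with
`I = ∫ e^{-c‖z‖/2} dz`. [folklore] -/
theorem fiberZ_le (hf : Continuous f) (hc : 0 < c) (hcoer : ∀ x, c * ‖x‖ - C₀ ≤ f x) (y : ℝ) :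
    ∫ z : Fin n → ℝ, Real.exp (-f (Fin.cons y z)) ≤
      Real.exp C₀ * Real.exp (-(c / 2) * |y|) * ∫ z : Fin n → ℝ, Real.exp (-(c / 2) * ‖z‖) := by
  rw [← integral_const_mul]
  refine integral_mono (integrable_fiber_exp hf hc hcoer y) ?_ fun z => ?_
  · have := (integrable_one_add_norm_pow_mul_exp_neg (k := n) (half_pos hc) 0).const_mul
      (Real.exp C₀ * Real.exp (-(c / 2) * |y|))
    simpa using this
  · simp only
    rw [← Real.exp_add, ← Real.exp_add]
    refine Real.exp_le_exp.2 ?_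
    have h1 := hcoer (Fin.cons y z)
    have h2 := abs_le_norm_cons y z
    have h3 : ‖z‖ ≤ ‖(Fin.cons y z : Fin (n + 1) → ℝ)‖ := norm_le_norm_cons y z
    nlinarith

/-- **The marginal potential attains its minimum**: `g = -log Z` is continuous and
`g(y) ≥ c|y|/2 - const`, so it has a global minimiser. [cite: BrascampLieb1976, Thm 4.1 (proof, p. 378)] -/
theorem exists_min_potential (hf : Continuous f) (hc : 0 < c) (hcoer : ∀ x, c * ‖x‖ - C₀ ≤ f x) :
    ∃ a : ℝ, ∀ y, -Real.log (∫ z : Fin n → ℝ, Real.exp (-f (Fin.cons a z))) ≤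
      -Real.log (∫ z : Fin n → ℝ, Real.exp (-f (Fin.cons y z))) := by
  set Z : ℝ → ℝ := fun y => ∫ z : Fin n → ℝ, Real.exp (-f (Fin.cons y z)) with hZ
  set I : ℝ := ∫ z : Fin n → ℝ, Real.exp (-(c / 2) * ‖z‖) with hI
  have hZpos : ∀ y, 0 < Z y := fun y => fiberZ_pos (integrable_fiber_exp hf hc hcoer) y
  have hIpos : 0 < I := by
    have hint : Integrable fun z : Fin n → ℝ => Real.exp (-(c / 2) * ‖z‖) := by
      simpa using integrable_one_add_norm_pow_mul_exp_neg (k := n) (half_pos hc) 0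
    refine (integral_pos_iff_support_of_nonneg (fun z => (Real.exp_pos _).le) hint).2 ?_
    have : Function.support (fun z : Fin n → ℝ => Real.exp (-(c / 2) * ‖z‖)) = univ := by
      ext z; simp [(Real.exp_pos _).ne']
    rw [this]
    exact Measure.measure_univ_pos.2 (NeZero.ne _)
  have hg_cont : Continuous fun y => -Real.log (Z y) :=
    ((continuous_fiberZ hf hc hcoer).log fun y => (hZpos y).ne').neg
  -- lower bound `g y ≥ c|y|/2 - C₀ - log I`
  have hlow : ∀ y, c / 2 * |y| - C₀ - Real.log I ≤ -Real.log (Z y) := by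
    intro y
    have h1 : Z y ≤ Real.exp C₀ * Real.exp (-(c / 2) * |y|) * I := fiberZ_le hf hc hcoer y
    have h2 : Real.log (Z y) ≤ Real.log (Real.exp C₀ * Real.exp (-(c / 2) * |y|) * I) :=
      Real.log_le_log (hZpos y) h1
    rw [Real.log_mul (by positivity) hIpos.ne', Real.log_mul (Real.exp_pos _).ne' (Real.exp_pos _).ne',
      Real.log_exp, Real.log_exp] at h2
    linarith
  -- outside a large ball `g > g 0`
  set R : ℝ := 2 / c * (-Real.log (Z 0) + C₀ + Real.log I + 1) with hR
  have hout : ∀ y, R < |y| → -Real.log (Z 0) < -Real.log (Z y) := by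
    intro y hy
    have := hlow y
    have hcy : c / 2 * R < c / 2 * |y| := by gcongr
    have e : c / 2 * R = -Real.log (Z 0) + C₀ + Real.log I + 1 := by
      rw [hR]; field_simp
    linarith
  -- minimum on the compact ball
  obtain ⟨a, ha, hmin⟩ := (isCompact_closedBall (0 : ℝ) R).exists_isMinOn
    ⟨0, mem_closedBall_self (by
      by_contra h
      push Not at h
      have := hout 0 (by simpa using h)
      exact lt_irrefl _ this)⟩
    hg_cont.continuousOn
  refine ⟨a, fun y => ?_⟩
  by_cases hy : |y| ≤ R
  · exact hmin (by simpa [Real.dist_eq] using hy)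
  · push Not at hy
    have h0 : -Real.log (Z a) ≤ -Real.log (Z 0) := hmin (mem_closedBall_self (by
      by_contra h
      push Not at h
      exact lt_irrefl _ (hout 0 (by simpa using h))))
    exact h0.trans (hout y hy).le

end Potential

end BrascampLiebMarginal

end Literature.Probability.Distributions
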